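import Mathlib

/-!
# Coefficient homogeneity for line `Sketch` (v2) of crux `CertWindowQP` (stmt-ValiantsHypothesis-5640)

Stub `stub_coeffHomog` of the registered skeleton. The determinantal-representability system
`Rep(n,m)` says `per_n(x) = det(A₀ + ∑ₑ xₑ Aₑ)` identically in `x`; its unknowns are the entries
of `A₀` (variables `(none,(i,j))`) and of the `Aₑ` (variables `(some e,(i,j))`). We prove that
every `x`-coefficient `P_μ(a) = coeff_μ det(A₀ + ∑ₑ xₑ Aₑ)` of the generic pencil determinant is a
homogeneous polynomial of degree `m` in the unknowns `a` (the bookkeeping input to the algebraic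
transfer via Briançon–Skoda in line `Sketch`, v2).

Proof: for `p : MvPolynomial σ (MvPolynomial τ R)` consider the property
"every `σ`-coefficient of `p` is homogeneous of degree `d`". It is preserved by sums; a product of
such polynomials of degrees `d` and `e` has the property in degree `d + e`
(`MvPolynomial.coeff_mul`, `MvPolynomial.IsHomogeneous.mul`); constants `C c` with `c` homogeneous
of degree `d`, variables `X e` (degree `0`) and integer constants (degree `0`) have it; the matrix
entries `C (X v) + ∑ₑ X e * C (X wₑ)` have it in degree `1`, so by the Leibniz formula
(`Matrix.det_apply'`) the determinant has it in degree `m`. Mathlib only. Note that the zero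
polynomial is homogeneous of every degree, so the claim holds for every exponent `μ`.
-/

open MvPolynomial

namespace Summit.ValiantsHypothesis.ValiantsHypothesis.Theorems
set_option linter.dupNamespace false

section CoeffHomog

variable {σ τ R : Type*} [CommRing R]

/-- The coefficients of `0` are homogeneous of every degree `d`. -/
private theorem coeffHomog_chd_zero (d : ℕ) :
    ∀ μ, ((0 : MvPolynomial σ (MvPolynomial τ R)).coeff μ).IsHomogeneous d :=
  fun μ => by simpa using isHomogeneous_zero τ R d

/-- Coefficientwise homogeneity (of a fixed degree) is preserved by addition. -/
private theorem coeffHomog_chd_add {d : ℕ} {p q : MvPolynomial σ (MvPolynomial τ R)}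
    (hp : ∀ μ, (p.coeff μ).IsHomogeneous d) (hq : ∀ μ, (q.coeff μ).IsHomogeneous d) :
    ∀ μ, ((p + q).coeff μ).IsHomogeneous d :=
  fun μ => by
    rw [coeff_add]
    exact (hp μ).add (hq μ)

/-- Coefficientwise homogeneity (of a fixed degree) is preserved by finite sums. -/
private theorem coeffHomog_chd_sum {ι : Type*} {d : ℕ} (s : Finset ι)
    {f : ι → MvPolynomial σ (MvPolynomial τ R)}
    (h : ∀ i ∈ s, ∀ μ, ((f i).coeff μ).IsHomogeneous d) :
    ∀ μ, ((∑ i ∈ s, f i).coeff μ).IsHomogeneous d :=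
  Finset.sum_induction f (fun p => ∀ μ, (p.coeff μ).IsHomogeneous d)
    (fun _ _ hp hq => coeffHomog_chd_add hp hq) (coeffHomog_chd_zero d) h

/-- Coefficientwise homogeneity degrees add under multiplication (`MvPolynomial.coeff_mul`). -/
private theorem coeffHomog_chd_mul {d e : ℕ} {p q : MvPolynomial σ (MvPolynomial τ R)}
    (hp : ∀ μ, (p.coeff μ).IsHomogeneous d) (hq : ∀ μ, (q.coeff μ).IsHomogeneous e) :
    ∀ μ, ((p * q).coeff μ).IsHomogeneous (d + e) :=
  fun μ => by
    classical
    rw [coeff_mul]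
    exact IsHomogeneous.sum _ _ _ fun x _ => (hp x.1).mul (hq x.2)

/-- The coefficients of a constant `C c`, with `c` homogeneous of degree `d`, are homogeneous of
degree `d` (they are `c` and `0`). -/
private theorem coeffHomog_chd_C {d : ℕ} {c : MvPolynomial τ R} (hc : c.IsHomogeneous d) :
    ∀ μ, ((C c : MvPolynomial σ (MvPolynomial τ R)).coeff μ).IsHomogeneous d :=
  fun μ => by
    classical
    rw [coeff_C]
    split_ifs
    · exact hc
    · exact isHomogeneous_zero τ R d

/-- The coefficients of a variable `X e` (namely `0` and `1`) are homogeneous of degree `0`. -/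
private theorem coeffHomog_chd_X (e : σ) :
    ∀ μ, ((X e : MvPolynomial σ (MvPolynomial τ R)).coeff μ).IsHomogeneous 0 :=
  fun μ => by
    classical
    rw [coeff_X]
    split_ifs
    · exact isHomogeneous_one τ R
    · exact isHomogeneous_zero τ R 0

/-- The coefficients of an integer constant are homogeneous of degree `0`. -/
private theorem coeffHomog_chd_intCast (k : ℤ) :
    ∀ μ, ((k : MvPolynomial σ (MvPolynomial τ R)).coeff μ).IsHomogeneous 0 := by
  have h : (k : MvPolynomial σ (MvPolynomial τ R)) = C (C (k : R)) := by simp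
  rw [h]
  exact coeffHomog_chd_C (isHomogeneous_C τ (k : R))

/-- A product over `s` of polynomials whose coefficients are homogeneous of degree `1` has
coefficients homogeneous of degree `#s`. -/
private theorem coeffHomog_chd_prod {ι : Type*} (s : Finset ι)
    {f : ι → MvPolynomial σ (MvPolynomial τ R)}
    (h : ∀ i ∈ s, ∀ μ, ((f i).coeff μ).IsHomogeneous 1) :
    ∀ μ, ((∏ i ∈ s, f i).coeff μ).IsHomogeneous s.card := by
  classical
  induction s using Finset.induction_on with
  | empty =>
    simpa using (coeffHomog_chd_C (σ := σ) (isHomogeneous_one τ R))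
  | insert a s ha ih =>
    rw [Finset.prod_insert ha, Finset.card_insert_of_notMem ha, add_comm]
    exact coeffHomog_chd_mul (h a (Finset.mem_insert_self a s))
      (ih fun i hi => h i (Finset.mem_insert_of_mem hi))

/-- **Leibniz homogeneity.** If every entry of a square matrix of polynomials has coefficients
homogeneous of degree `1`, the coefficients of its determinant are homogeneous of degree the size
of the matrix. -/
private theorem coeffHomog_chd_det {k : Type*} [Fintype k] [DecidableEq k]
    {M : Matrix k k (MvPolynomial σ (MvPolynomial τ R))}
    (hM : ∀ i j, ∀ μ, ((M i j).coeff μ).IsHomogeneous 1) :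
    ∀ μ, (M.det.coeff μ).IsHomogeneous (Fintype.card k) := by
  rw [Matrix.det_apply']
  refine coeffHomog_chd_sum _ fun π _ => ?_
  simpa [Finset.card_univ] using coeffHomog_chd_mul (coeffHomog_chd_intCast _)
    (coeffHomog_chd_prod Finset.univ fun i _ => hM (π i) i)

end CoeffHomog

/-- Every `x`-coefficient `P_μ(a) = coeff_μ det(A₀ + ∑ₑ xₑ Aₑ)` of the generic pencil determinant
is a homogeneous polynomial of degree `m` in the `(n²+1)m²` unknown entries `a` (the determinant
is a sum of signed products of `m` entries, each of which has `x`-coefficients homogeneous of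
degree `1` in the unknowns). -/
theorem certWindowQP_coeffHomog (n m : ℕ) (μ : (Fin n × Fin n) →₀ ℕ) :
    (MvPolynomial.coeff μ (Matrix.of fun i j : Fin m => MvPolynomial.C (MvPolynomial.X (none, (i, j))) + ∑ e : Fin n × Fin n, MvPolynomial.X e * MvPolynomial.C (MvPolynomial.X (some e, (i, j))) : Matrix (Fin m) (Fin m) (MvPolynomial (Fin n × Fin n) (MvPolynomial (Option (Fin n × Fin n) × (Fin m × Fin m)) ℂ))).det).IsHomogeneous m := by
  have hdet := coeffHomog_chd_det (σ := Fin n × Fin n)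
    (τ := Option (Fin n × Fin n) × (Fin m × Fin m)) (R := ℂ)
    (M := Matrix.of fun i j : Fin m => MvPolynomial.C (MvPolynomial.X (none, (i, j))) +
      ∑ e : Fin n × Fin n, MvPolynomial.X e * MvPolynomial.C (MvPolynomial.X (some e, (i, j))))
    (fun i j => ?_) μ
  · simpa using hdet
  · rw [Matrix.of_apply]
    refine coeffHomog_chd_add (coeffHomog_chd_C (isHomogeneous_X ℂ _))
      (coeffHomog_chd_sum _ fun e _ => ?_)
    simpa using coeffHomog_chd_mul (coeffHomog_chd_X e)
      (coeffHomog_chd_C (σ := Fin n × Fin n) (isHomogeneous_X ℂ (some e, (i, j))))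

/-- **Registered stub `stub_coeffHomog`** of line `Sketch` (v2, algebraic transfer) of crux
`CertWindowQP` (stmt-ValiantsHypothesis-5640), verbatim signature of the registered skeleton;
proved by `certWindowQP_coeffHomog`. -/
theorem stub_coeffHomog (n m : ℕ) (μ : (Fin n × Fin n) →₀ ℕ) :
    (MvPolynomial.coeff μ (Matrix.of fun i j : Fin m => MvPolynomial.C (MvPolynomial.X (none, (i, j))) + ∑ e : Fin n × Fin n, MvPolynomial.X e * MvPolynomial.C (MvPolynomial.X (some e, (i, j))) : Matrix (Fin m) (Fin m) (MvPolynomial (Fin n × Fin n) (MvPolynomial (Option (Fin n × Fin n) × (Fin m × Fin m)) ℂ))).det).IsHomogeneous m :=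
  certWindowQP_coeffHomog n m μ

end Summit.ValiantsHypothesis.ValiantsHypothesis.Theorems
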